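import Summits.RiemannHypothesis.RiemannHypothesis.Theorems.JensenPolynomialsSkeletonQuotDefs
import Literature.Analysis.SpecialFunctions.LaguerreInterlacingRatios

/-!
# Route `JensenPolynomials` — rung J-P (P1⁺): the K-TABLE FROM LEMMA L1 — an explicit ratio table for the skeleton sign test,
# modulo a zero bracket for `L_{d−1}^{(n−½)}`

**RH-FREE, ξ-free** (arbitrary `γ` with `κ_n > 0`; `b = n + ½`, `c = bκ_n`, `s = √(d(b+d−2))`). Plugging the tree's LEMMA L1
(`Literature.Analysis.SpecialFunctions.laguerre_interlacingRatio_abs_le`, the perturbed-Chebyshev bound for the Laguerre value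
ratios at the zeros of `L_{d−1}^{(b−1)}`) into the adapter `kTable_of_laguerre_bound` gives (`kTable_of_interlacingRatio`): for
`3 ≤ m ≤ d` and every L1-majorant `M` (`M_k ≥ (k+1) + Σ_{1≤j<k}(k−j)(j·(2/s)·M_j + ((j+1)/d + j/(b+d−2))·M_{j−1})`, `M_k ≥ 0`), IF every
zero `τ` of `L_{d−1}^{(n−½)}` satisfies the oscillatory window `(τ − (b+2d−4))² ≤ 4d(b+d−2)` and `|τ| ≤ T`, THEN the order-`m` ratio clause
of the blueprint holds with

  `K_m = ((d−m)!/d!)·(T/c)^m·(b+d−1)·d·s^{m−2}·M_{m−2}`.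

The zero hypotheses are the Ismail–Li bracket (Proc. AMS 115 (1992); WANTED acq-11409, not in the tree), under which
`T = 2d + b − 5 + √(1+4(d−2)(d+b−3))`; here they are explicit antecedents. So the K-side of `skeletonSignTest_of_tables` /
`skeletonSignTestLaw_xi_of_named_tables` is now: Ismail–Li + a majorant `M` + arithmetic. Nothing here bears on the truth of RH.
-/

noncomputable section
-- D-0017: `Summit.RiemannHypothesis.RiemannHypothesis.…` duplicates the namespace BY DESIGN (single-problem summit).
set_option linter.dupNamespace false

namespace Summit.RiemannHypothesis.RiemannHypothesis.Theorems.JensenPolynomials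

open Literature.NumberTheory.LFunctions Polynomial Finset
open Literature.Analysis.SpecialFunctions (laguerre laguerre_interlacingRatio_abs_le ascPochhammer_eval_mul_eval_add)
open scoped BigOperators Nat

/-- **K-table from LEMMA L1 (RH-FREE, ξ-free).** Let `κ_n > 0`, `2 ≤ d`, `3 ≤ m ≤ d`, `b = n + ½`, `c = bκ_n`, `s = √(d(b+d−2))`; let `M` be an
L1-majorant (`hM`) with `M ≥ 0`, and suppose every zero `τ` of `L_{d−1}^{(n−½)}` lies in the oscillatory window
`(τ − (b+2d−4))² ≤ 4d(b+d−2)` and has `|τ| ≤ T`. Then at every critical point `e` of the skeleton `A^d_{s_n}`: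
`|A^{d−m}_{s_n}(e)| ≤ K_m·|A^d_{s_n}(e)|` with `K_m = ((d−m)!/d!)·(T/c)^m·(b+d−1)·d·s^{m−2}·M_{m−2}`. -/
theorem kTable_of_interlacingRatio (γ : ℕ → ℝ) (n d m : ℕ) (hd : 2 ≤ d) (hm3 : 3 ≤ m) (hmd : m ≤ d)
    (hκ : 0 < skelKappa γ n) {M : ℕ → ℝ}
    (hM : ∀ k : ℕ, k ≤ d - 2 →
      (k + 1 : ℝ) + ∑ j ∈ Ico 1 k, ((k : ℝ) - j) *
        (j * (2 / Real.sqrt (d * ((n : ℝ) + 1 / 2 + d - 2))) * M j +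
          ((j + 1) / d + j / ((n : ℝ) + 1 / 2 + d - 2)) * M (j - 1)) ≤ M k)
    (hM0 : ∀ k : ℕ, k ≤ d - 2 → 0 ≤ M k) {T : ℝ}
    (hzero : ∀ τ : ℝ, (laguerre ((n : ℝ) - 1 / 2) (d - 1)).eval τ = 0 →
      (τ - ((n : ℝ) + 1 / 2 + 2 * d - 4)) ^ 2 ≤ 4 * (d * ((n : ℝ) + 1 / 2 + d - 2)) ∧ |τ| ≤ T) :
    ∀ e : ℝ, (derivative (appellPoly (skeletonSeq γ n) d)).eval e = 0 →
      |(appellPoly (skeletonSeq γ n) (d - m)).eval e| ≤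
        ((((d - m) ! : ℕ) : ℝ) / (d ! : ℝ) * (T / (((n : ℝ) + 1 / 2) * skelKappa γ n)) ^ m *
          ((n : ℝ) + 1 / 2 + d - 1) * d * Real.sqrt (d * ((n : ℝ) + 1 / 2 + d - 2)) ^ (m - 2) * M (m - 2)) *
        |(appellPoly (skeletonSeq γ n) d).eval e| := by
  have hb : (0 : ℝ) < (n : ℝ) + 1 / 2 := by positivity
  have hc : 0 < ((n : ℝ) + 1 / 2) * skelKappa γ n := mul_pos hb hκ
  have hd0 : (0 : ℝ) < d := by exact_mod_cast (by omega : 0 < d)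
  have hd2 : (2 : ℝ) ≤ d := by exact_mod_cast hd
  have hbd2 : 0 < (n : ℝ) + 1 / 2 + d - 2 := by linarith
  refine kTable_of_laguerre_bound γ n d m hd hmd hκ _ fun τ hτ => ?_
  obtain ⟨hosc, hτT⟩ := hzero τ hτ
  have hT0 : 0 ≤ T := (abs_nonneg τ).trans hτT
  -- LEMMA L1 at `k = m − 2`
  have hτ' : (laguerre ((n : ℝ) + 1 / 2 - 1) (d - 1)).eval τ = 0 := by
    rw [show (n : ℝ) + 1 / 2 - 1 = (n : ℝ) - 1 / 2 by ring]; exact hτ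
  have hL1 := laguerre_interlacingRatio_abs_le (b := (n : ℝ) + 1 / 2) hb hd hτ' hosc hM (m - 2) (by omega)
  rw [show (n : ℝ) + 1 / 2 - 1 = (n : ℝ) - 1 / 2 by ring, show d - 2 - (m - 2) = d - m by omega,
    show m - 2 + 2 = m by omega, Nat.cast_sub (by omega : 2 ≤ m), Nat.cast_two,
    show (n : ℝ) + 1 / 2 + d - 2 - ((m : ℝ) - 2) = (n : ℝ) + 1 / 2 + d - m by ring] at hL1
  -- abbreviations (all positive)
  set b : ℝ := (n : ℝ) + 1 / 2 with hbdef
  set c : ℝ := b * skelKappa γ n with hcdef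
  set s : ℝ := Real.sqrt (d * (b + d - 2)) with hsdef
  set P : ℝ := (ascPochhammer ℝ m).eval (b + d - m) with hPdef
  set Pd : ℝ := (ascPochhammer ℝ d).eval b with hPd
  set Pdm : ℝ := (ascPochhammer ℝ (d - m)).eval b with hPdm
  set Lm : ℝ := |(laguerre ((n : ℝ) - 1 / 2) (d - m)).eval τ| with hLm
  set L2 : ℝ := |(laguerre ((n : ℝ) - 1 / 2) (d - 2)).eval τ| with hL2
  have hP : 0 < P := ascPochhammer_pos _ _ (by
    have : (m : ℝ) ≤ d := by exact_mod_cast hmd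
    linarith)
  have hPd0 : 0 < Pd := ascPochhammer_pos _ _ hb
  have hPdm0 : 0 < Pdm := ascPochhammer_pos _ _ hb
  have hs0 : 0 ≤ s := Real.sqrt_nonneg _
  have hMm : 0 ≤ M (m - 2) := hM0 _ (by omega)
  have hLm0 : 0 ≤ Lm := abs_nonneg _
  have hL20 : 0 ≤ L2 := abs_nonneg _
  -- the Pochhammer splitting `(b)_{d−m}·(b+d−m)_m = (b)_d`
  have hsplit : Pdm * P = Pd := by
    have h := ascPochhammer_eval_mul_eval_add (d - m) m b
    rwa [Nat.cast_sub hmd, show b + ((d : ℝ) - m) = b + d - m by ring, Nat.sub_add_cancel hmd] at h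
  -- from L1: `Lm ≤ (b+d−2)(b+d−1) s^{m−2} M_{m−2} L2 / P`
  have hLm_le : Lm ≤ (b + d - 2) * (b + d - 1) * s ^ (m - 2) * M (m - 2) * L2 / P := by
    rw [le_div_iff₀ hP, mul_comm Lm P]
    exact hL1
  -- `|τ|^m ≤ T^m`
  have hτm : |τ| ^ m ≤ T ^ m := pow_le_pow_left₀ (abs_nonneg τ) hτT m
  -- the chain
  have hfac0 : 0 ≤ (((d - m) ! : ℕ) : ℝ) / Pdm := div_nonneg (Nat.cast_nonneg _) hPdm0.le
  calc (((d - m) ! : ℕ) : ℝ) / Pdm * |τ| ^ m * Lm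
      ≤ (((d - m) ! : ℕ) : ℝ) / Pdm * T ^ m *
          ((b + d - 2) * (b + d - 1) * s ^ (m - 2) * M (m - 2) * L2 / P) := by
        have h1 : (((d - m) ! : ℕ) : ℝ) / Pdm * |τ| ^ m ≤ (((d - m) ! : ℕ) : ℝ) / Pdm * T ^ m :=
          mul_le_mul_of_nonneg_left hτm hfac0
        exact mul_le_mul h1 hLm_le hLm0 (mul_nonneg hfac0 (pow_nonneg hT0 m))
    _ = (((d - m) ! : ℕ) : ℝ) / (d ! : ℝ) * (T / c) ^ m * (b + d - 1) * d * s ^ (m - 2) * M (m - 2) *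
          (c ^ m * ((d ! : ℝ) / Pd) * ((b + d - 2) / d)) * L2 := by
        rw [← hsplit, div_pow]
        have hdf : (0 : ℝ) < d ! := by exact_mod_cast Nat.factorial_pos d
        have hcm : c ^ m ≠ 0 := pow_ne_zero m hc.ne'
        field_simp

end Summit.RiemannHypothesis.RiemannHypothesis.Theorems.JensenPolynomials

end
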